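import Literature.AlgebraicGeometry.ProjectiveSpace.LinearChangeOfCoordinates
import Literature.AlgebraicGeometry.Motives.SegreEmbedding
import Mathlib.AlgebraicGeometry.ProjectiveSpectrum.Functor
import HarnessLib

/-!
# [OURS · L1 W4.5(b) · EL♮(3) · certificate infrastructure (L)] LINEAR CHANGES OF COORDINATES OF `ℙⁿ_k` AS SCHEME AUTOMORPHISMS,
# and the transport of zero loci `φ⁻¹ V₊(F) = V₊(F ∘ B)`

Cell `res-hironaka`, LADDER-RESOLUTION rung L (D-0089), slot W4.5(b), crux chain w45b: child crux **EL♮(3)** = stmt-ResolutionOfSingularities-20148.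
WIDTH seat res-L1-w45b-iso-w4 g2 (D-0157 DOOR 1), free-hand brick (L) (STATUS 2026-08-28T19:13Z, TAKING-UNLESS-VETOED): the piece named «Aut(ℙ²)
preserves lines — not typed» in the NEST-line / model-door discussion (res-L1-w45b-iso-w2, STATUS ≈19:12Z). `--supports stmt-ResolutionOfSingularities-20148
--as helper`. OURS; NOT a statement of H. Hironaka's 2017 manuscript (nothing of [Hironaka2017] is asserted); AI-written, and AI review is weaker than
expert review. DEF-FREE (the automorphism is delivered in `∃` form); no `sorry`; standard axioms. EL♮(3) is NOT proved here; resolution of singularities in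
positive characteristic is NOT proved here (dimension 3 is Cossart–Piltant 2008/2009 in print); counted 0 toward the summit.

WHAT. For a field `k`, `n`, and a matrix `B : Matrix (Fin (n+1)) (Fin (n+1)) k` with `IsUnit B.det`, the substitution `F ↦ F ∘ B`
(`MvPolynomial.aeval B.toMvPolynomial`, the tree's `Literature/AlgebraicGeometry/ProjectiveSpace/LinearChangeOfCoordinates`: degree-preserving,
`(F ∘ C) ∘ B = F ∘ (C B)`, inverse `B⁻¹`) is a GRADED automorphism of `k[X₀,…,Xₙ]`, hence (Mathlib `Proj.map`, `Proj.map_comp`, `Proj.map_id`) a scheme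
automorphism of `ℙⁿ_k = Proj k[X₀,…,Xₙ]` acting on points by `𝔭 ↦ (F ↦ F ∘ B)⁻¹ 𝔭`:
* `ProjLin.isHomogeneous_mem` / `irrelevant_le_map` — bookkeeping: the substitution preserves the grading; the irrelevant ideal is in the image;
* ★★ `ProjLin.exists_iso_comap` — `∃ φ : ℙⁿ_k ≅ ℙⁿ_k, ∀ 𝔭 F, F ∈ (φ 𝔭) ↔ F ∘ B ∈ 𝔭` (membership in the homogeneous prime of the image point);
* ★★ `ProjLin.exists_iso_preimage_zeroLocus` — `∃ φ : ℙⁿ_k ≅ ℙⁿ_k, ∀ F, φ ⁻¹ V₊(F) = V₊(F ∘ B)`, and `…image_zeroLocus`: `φ '' V₊(F ∘ B) = V₊(F)`;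
  hence (Harris, Lecture 1: «projectively equivalent») every hypersurface projectively equivalent to `V₊(F)` is the image of `V₊(F)` under a scheme
  automorphism of `ℙⁿ_k` — the input that turns a NORMAL-FORM certificate (a conic `X₀X₁ + X₂²`, a line `X₀`) plus a transport-along-isomorphisms
  lemma (`S10Conic.dirStepUnobs_conic_of_iso`, res-L1-w45b-iso-w2's (H2) `dirStepUnobs_of_model_iso`) into a statement about EVERY conic / line;
* (appended 2026-08-28T20:04Z, same seat) ★★ `ProjLin.exists_iso_eq_map` — the automorphism in the form `φ.hom = Proj.map g _`, `φ.inv = Proj.map g' _`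
  with `g = (· ∘ B)`, `g' = (· ∘ B⁻¹)` (unlocks Mathlib's `Proj.map_preimage_basicOpen` / `awayToSection_comp_appLE` / `awayι_comp_map` for chart
  computations), and ★★ `ProjLin.exists_iso_preimage_basicOpen` — point laws for `φ`, `φ⁻¹` and `φ⁻¹ D₊(s) = D₊(s ∘ B)` as opens, in one `∃`.

References (index only): J. Harris, *Algebraic Geometry: A First Course* (1992), Lecture 1 p. 4 [cite: Harris1992]; R. Hartshorne, *Algebraic Geometry*
(1977), II Ex. 2.14, II.7.1.1 (automorphisms of `ℙⁿ`) [cite: Hartshorne1977].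
-/

set_option linter.dupNamespace false

noncomputable section

-- `Proj`/`ProjectiveSpectrum` carrier coercions under `instances` transparency (as in the chain's other chart files).
set_option backward.isDefEq.respectTransparency false

open CategoryTheory AlgebraicGeometry MvPolynomial

namespace Summit.ResolutionOfSingularities.ResolutionOfSingularities.Cruxes.EquisingularLiftNat.Sections

namespace ProjLin

open Literature.AlgebraicGeometry.ProjectiveSpace

variable {k : Type} [Field k] {n : ℕ}

attribute [local instance] MvPolynomial.gradedAlgebra

/-- The substitution `F ↦ F ∘ B` maps the degree-`i` piece of `k[X₀,…,Xₙ]` into itself. [cite: Harris1992, Lecture 1 (p. 4)] -/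
theorem isHomogeneous_mem (B : Matrix (Fin (n + 1)) (Fin (n + 1)) k) {i : ℕ} {x : MvPolynomial (Fin (n + 1)) k}
    (hx : x ∈ MvPolynomial.homogeneousSubmodule (Fin (n + 1)) k i) :
    aeval B.toMvPolynomial x ∈ MvPolynomial.homogeneousSubmodule (Fin (n + 1)) k i := by
  rw [mem_homogeneousSubmodule] at hx ⊢
  exact IsHomogeneous.aeval_toMvPolynomial B hx

/-- An element of the irrelevant ideal stays in the irrelevant ideal under `F ↦ F ∘ B` (degree-`0` components correspond).
[cite: Harris1992, Lecture 1 (p. 4)] -/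
theorem mem_irrelevant_aeval (B : Matrix (Fin (n + 1)) (Fin (n + 1)) k) {x : MvPolynomial (Fin (n + 1)) k}
    (hx : x ∈ HomogeneousIdeal.irrelevant (MvPolynomial.homogeneousSubmodule (Fin (n + 1)) k)) :
    aeval B.toMvPolynomial x ∈ HomogeneousIdeal.irrelevant (MvPolynomial.homogeneousSubmodule (Fin (n + 1)) k) := by
  -- the irrelevant ideal is generated by the variables, and `X_i ∘ B` is a linear form
  have h1 := Literature.AlgebraicGeometry.Motives.Segre.irrelevant_le_span_X (Fin (n + 1)) k hx
  have h2 : aeval B.toMvPolynomial x ∈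
      Ideal.map (aeval B.toMvPolynomial : MvPolynomial (Fin (n + 1)) k →ₐ[k] _).toRingHom (Ideal.span (Set.range X)) :=
    Ideal.mem_map_of_mem _ h1
  rw [Ideal.map_span] at h2
  change aeval B.toMvPolynomial x ∈ (HomogeneousIdeal.irrelevant (MvPolynomial.homogeneousSubmodule (Fin (n + 1)) k)).toIdeal
  refine (Ideal.span_le.2 ?_) h2
  rintro _ ⟨_, ⟨i, rfl⟩, rfl⟩
  rw [SetLike.mem_coe]
  change aeval B.toMvPolynomial (X i) ∈ (HomogeneousIdeal.irrelevant (MvPolynomial.homogeneousSubmodule (Fin (n + 1)) k)).toIdeal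
  rw [aeval_X]
  exact HomogeneousIdeal.mem_irrelevant_of_mem _ Nat.one_pos (Matrix.toMvPolynomial_isHomogeneous B i)

/-- For `det B` a unit, the irrelevant ideal lies in its own image under `F ↦ F ∘ B` (the hypothesis of Mathlib's `Proj.map`), for any graded
homomorphism `g` that is the substitution on elements. [cite: Harris1992, Lecture 1 (p. 4)] -/
theorem irrelevant_le_map {B : Matrix (Fin (n + 1)) (Fin (n + 1)) k} (hB : IsUnit B.det)
    (g : MvPolynomial.homogeneousSubmodule (Fin (n + 1)) k →+*ᵍ MvPolynomial.homogeneousSubmodule (Fin (n + 1)) k)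
    (hg : ∀ x, g x = aeval B.toMvPolynomial x) :
    HomogeneousIdeal.irrelevant (MvPolynomial.homogeneousSubmodule (Fin (n + 1)) k) ≤
      (HomogeneousIdeal.irrelevant (MvPolynomial.homogeneousSubmodule (Fin (n + 1)) k)).map g := by
  classical
  intro x hx
  change x ∈ Ideal.map g (HomogeneousIdeal.irrelevant (MvPolynomial.homogeneousSubmodule (Fin (n + 1)) k)).toIdeal
  have hx' : aeval B⁻¹.toMvPolynomial x ∈ HomogeneousIdeal.irrelevant (MvPolynomial.homogeneousSubmodule (Fin (n + 1)) k) :=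
    mem_irrelevant_aeval B⁻¹ hx
  have : x = g (aeval B⁻¹.toMvPolynomial x) := by rw [hg, aeval_toMvPolynomial_inv_left hB]
  rw [this]
  exact Ideal.mem_map_of_mem _ hx'

/-- ★★ **Linear changes of coordinates are automorphisms of `ℙⁿ_k`, acting on points by pulling back homogeneous primes.**  For `det B` a unit there
is an isomorphism of schemes `φ : Proj k[X₀,…,Xₙ] ≅ Proj k[X₀,…,Xₙ]` with `F ∈ 𝔭_{φ(p)} ⟺ F ∘ B ∈ 𝔭_p` for every point `p` and every polynomial `F`
(Mathlib `Proj.map` of the graded substitution homomorphism; inverse = the substitution of `B⁻¹`). [cite: Hartshorne1977, II.7.1.1] -/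
theorem exists_iso_comap {B : Matrix (Fin (n + 1)) (Fin (n + 1)) k} (hB : IsUnit B.det) :
    ∃ φ : Proj (MvPolynomial.homogeneousSubmodule (Fin (n + 1)) k) ≅ Proj (MvPolynomial.homogeneousSubmodule (Fin (n + 1)) k),
      ∀ (p : Proj (MvPolynomial.homogeneousSubmodule (Fin (n + 1)) k)) (F : MvPolynomial (Fin (n + 1)) k),
        F ∈ ((φ.hom : Proj _ → Proj _) p).asHomogeneousIdeal ↔ aeval B.toMvPolynomial F ∈ p.asHomogeneousIdeal := by
  classical
  have hB' : IsUnit B⁻¹.det := Matrix.isUnit_nonsing_inv_det_iff.2 hB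
  -- the two graded substitution homomorphisms
  let g : MvPolynomial.homogeneousSubmodule (Fin (n + 1)) k →+*ᵍ MvPolynomial.homogeneousSubmodule (Fin (n + 1)) k :=
    { (aeval B.toMvPolynomial : MvPolynomial (Fin (n + 1)) k →ₐ[k] _).toRingHom with map_mem := fun hx => isHomogeneous_mem B hx }
  let g' : MvPolynomial.homogeneousSubmodule (Fin (n + 1)) k →+*ᵍ MvPolynomial.homogeneousSubmodule (Fin (n + 1)) k :=
    { (aeval B⁻¹.toMvPolynomial : MvPolynomial (Fin (n + 1)) k →ₐ[k] _).toRingHom with map_mem := fun hx => isHomogeneous_mem B⁻¹ hx }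
  have hg : ∀ x, g x = aeval B.toMvPolynomial x := fun x => rfl
  have hg' : ∀ x, g' x = aeval B⁻¹.toMvPolynomial x := fun x => rfl
  have hirr := irrelevant_le_map hB g hg
  have hirr' := irrelevant_le_map hB' g' hg'
  -- `g ∘ g' = id = g' ∘ g`
  have hcomp : g.comp g' = GradedRingHom.id _ := by
    ext x : 1
    change g (g' x) = x
    rw [hg, hg', aeval_toMvPolynomial_inv_left hB]
  have hcomp' : g'.comp g = GradedRingHom.id _ := by
    ext x : 1
    change g' (g x) = x
    rw [hg, hg', aeval_toMvPolynomial_inv_right hB]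
  have hid : ∀ (f : MvPolynomial.homogeneousSubmodule (Fin (n + 1)) k →+*ᵍ MvPolynomial.homogeneousSubmodule (Fin (n + 1)) k)
      (hf : HomogeneousIdeal.irrelevant _ ≤ (HomogeneousIdeal.irrelevant _).map f), f = GradedRingHom.id _ → Proj.map f hf = 𝟙 _ := by
    rintro f hf rfl; exact Proj.map_id
  refine ⟨⟨Proj.map g hirr, Proj.map g' hirr', ?_, ?_⟩, fun p F => Iff.rfl⟩
  · rw [← Proj.map_comp]; exact hid _ _ hcomp
  · rw [← Proj.map_comp]; exact hid _ _ hcomp'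

/-- ★★ **Transport of zero loci**: for `det B` a unit there is a scheme automorphism `φ` of `ℙⁿ_k` with `φ⁻¹ V₊(F) = V₊(F ∘ B)` for every `F`
(`F ∘ B = aeval B.toMvPolynomial F`). [cite: Harris1992, Lecture 1 (p. 4)] -/
theorem exists_iso_preimage_zeroLocus {B : Matrix (Fin (n + 1)) (Fin (n + 1)) k} (hB : IsUnit B.det) :
    ∃ φ : Proj (MvPolynomial.homogeneousSubmodule (Fin (n + 1)) k) ≅ Proj (MvPolynomial.homogeneousSubmodule (Fin (n + 1)) k),
      ∀ F : MvPolynomial (Fin (n + 1)) k,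
        (φ.hom : Proj _ → Proj _) ⁻¹' ProjectiveSpectrum.zeroLocus (MvPolynomial.homogeneousSubmodule (Fin (n + 1)) k) {F} =
          ProjectiveSpectrum.zeroLocus (MvPolynomial.homogeneousSubmodule (Fin (n + 1)) k) {aeval B.toMvPolynomial F} := by
  obtain ⟨φ, hφ⟩ := exists_iso_comap hB
  refine ⟨φ, fun F => ?_⟩
  ext p
  rw [Set.mem_preimage]
  change (φ.hom : Proj _ → Proj _) p ∈ ProjectiveSpectrum.zeroLocus _ {F} ↔ p ∈ ProjectiveSpectrum.zeroLocus _ {aeval B.toMvPolynomial F}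
  rw [ProjectiveSpectrum.mem_zeroLocus, ProjectiveSpectrum.mem_zeroLocus, Set.singleton_subset_iff,
    Set.singleton_subset_iff, SetLike.mem_coe, SetLike.mem_coe, hφ]

/-- ★★ **Transport of zero loci, image form**: `φ '' V₊(F ∘ B) = V₊(F)` for the same automorphism (it is a bijection on points).
[cite: Harris1992, Lecture 1 (p. 4)] -/
theorem exists_iso_image_zeroLocus {B : Matrix (Fin (n + 1)) (Fin (n + 1)) k} (hB : IsUnit B.det) :
    ∃ φ : Proj (MvPolynomial.homogeneousSubmodule (Fin (n + 1)) k) ≅ Proj (MvPolynomial.homogeneousSubmodule (Fin (n + 1)) k),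
      ∀ F : MvPolynomial (Fin (n + 1)) k,
        (φ.hom : Proj _ → Proj _) '' ProjectiveSpectrum.zeroLocus (MvPolynomial.homogeneousSubmodule (Fin (n + 1)) k) {aeval B.toMvPolynomial F} =
          ProjectiveSpectrum.zeroLocus (MvPolynomial.homogeneousSubmodule (Fin (n + 1)) k) {F} := by
  obtain ⟨φ, hφ⟩ := exists_iso_preimage_zeroLocus hB
  refine ⟨φ, fun F => ?_⟩
  rw [← hφ F]
  refine Set.image_preimage_eq _ fun y => ⟨φ.inv y, ?_⟩
  change (φ.inv ≫ φ.hom : Proj _ ⟶ Proj _) y = y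
  rw [Iso.inv_hom_id]; rfl

/-- ★★ **The automorphism IS Mathlib's `Proj.map` of the graded substitution** — for `det B` a unit there are graded endomorphisms `g = (· ∘ B)` and
`g' = (· ∘ B⁻¹)` of `k[X₀,…,Xₙ]` satisfying the `Proj.map` hypothesis (the irrelevant ideal lies in its image), and an isomorphism `φ` of `ℙⁿ_k` with
`φ.hom = Proj.map g _` and `φ.inv = Proj.map g' _`.  This form hands every user the whole `Proj.map` API of Mathlib (`Proj.map_preimage_basicOpen`:
`φ⁻¹ D₊(s) = D₊(s ∘ B)` as opens; `Proj.awayToSection_comp_appLE`: on sections over `D₊(s)` the map is `Away.map g s`, i.e. `x/sᵐ ↦ (x∘B)/(s∘B)ᵐ`;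
`Proj.awayι_comp_map`: compatibility with the affine charts `Spec k[X]_{(s)} → ℙⁿ`). [cite: Hartshorne1977, II.7.1.1] -/
theorem exists_iso_eq_map {B : Matrix (Fin (n + 1)) (Fin (n + 1)) k} (hB : IsUnit B.det) :
    ∃ (g g' : MvPolynomial.homogeneousSubmodule (Fin (n + 1)) k →+*ᵍ MvPolynomial.homogeneousSubmodule (Fin (n + 1)) k)
      (hg : HomogeneousIdeal.irrelevant (MvPolynomial.homogeneousSubmodule (Fin (n + 1)) k) ≤
        (HomogeneousIdeal.irrelevant (MvPolynomial.homogeneousSubmodule (Fin (n + 1)) k)).map g)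
      (hg' : HomogeneousIdeal.irrelevant (MvPolynomial.homogeneousSubmodule (Fin (n + 1)) k) ≤
        (HomogeneousIdeal.irrelevant (MvPolynomial.homogeneousSubmodule (Fin (n + 1)) k)).map g')
      (φ : Proj (MvPolynomial.homogeneousSubmodule (Fin (n + 1)) k) ≅ Proj (MvPolynomial.homogeneousSubmodule (Fin (n + 1)) k)),
      (∀ x, g x = aeval B.toMvPolynomial x) ∧ (∀ x, g' x = aeval B⁻¹.toMvPolynomial x) ∧
        φ.hom = Proj.map g hg ∧ φ.inv = Proj.map g' hg' := by
  classical
  have hB' : IsUnit B⁻¹.det := Matrix.isUnit_nonsing_inv_det_iff.2 hB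
  let g : MvPolynomial.homogeneousSubmodule (Fin (n + 1)) k →+*ᵍ MvPolynomial.homogeneousSubmodule (Fin (n + 1)) k :=
    { (aeval B.toMvPolynomial : MvPolynomial (Fin (n + 1)) k →ₐ[k] _).toRingHom with map_mem := fun hx => isHomogeneous_mem B hx }
  let g' : MvPolynomial.homogeneousSubmodule (Fin (n + 1)) k →+*ᵍ MvPolynomial.homogeneousSubmodule (Fin (n + 1)) k :=
    { (aeval B⁻¹.toMvPolynomial : MvPolynomial (Fin (n + 1)) k →ₐ[k] _).toRingHom with map_mem := fun hx => isHomogeneous_mem B⁻¹ hx }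
  have hg : ∀ x, g x = aeval B.toMvPolynomial x := fun x => rfl
  have hg' : ∀ x, g' x = aeval B⁻¹.toMvPolynomial x := fun x => rfl
  have hirr := irrelevant_le_map hB g hg
  have hirr' := irrelevant_le_map hB' g' hg'
  have hcomp : g.comp g' = GradedRingHom.id _ := by
    ext x : 1
    change g (g' x) = x
    rw [hg, hg', aeval_toMvPolynomial_inv_left hB]
  have hcomp' : g'.comp g = GradedRingHom.id _ := by
    ext x : 1
    change g' (g x) = x
    rw [hg, hg', aeval_toMvPolynomial_inv_right hB]
  have hid : ∀ (f : MvPolynomial.homogeneousSubmodule (Fin (n + 1)) k →+*ᵍ MvPolynomial.homogeneousSubmodule (Fin (n + 1)) k)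
      (hf : HomogeneousIdeal.irrelevant _ ≤ (HomogeneousIdeal.irrelevant _).map f), f = GradedRingHom.id _ → Proj.map f hf = 𝟙 _ := by
    rintro f hf rfl; exact Proj.map_id
  refine ⟨g, g', hirr, hirr', ⟨Proj.map g hirr, Proj.map g' hirr', ?_, ?_⟩, hg, hg', rfl, rfl⟩
  · rw [← Proj.map_comp]; exact hid _ _ hcomp
  · rw [← Proj.map_comp]; exact hid _ _ hcomp'

/-- ★★ **Charts law** (consequence of `exists_iso_eq_map`): one automorphism `φ` of `ℙⁿ_k` with, simultaneously, the point laws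
`F ∈ 𝔭_{φ(p)} ⟺ F ∘ B ∈ 𝔭_p` and `F ∈ 𝔭_{φ⁻¹(p)} ⟺ F ∘ B⁻¹ ∈ 𝔭_p`, and the standard-open laws `φ⁻¹ D₊(s) = D₊(s ∘ B)`,
`(φ⁻¹)⁻¹ D₊(s) = D₊(s ∘ B⁻¹)` as OPENS of `ℙⁿ_k` (what a chart-by-chart computation on a transported subscheme needs). [cite: Hartshorne1977, II.7.1.1] -/
theorem exists_iso_preimage_basicOpen {B : Matrix (Fin (n + 1)) (Fin (n + 1)) k} (hB : IsUnit B.det) :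
    ∃ φ : Proj (MvPolynomial.homogeneousSubmodule (Fin (n + 1)) k) ≅ Proj (MvPolynomial.homogeneousSubmodule (Fin (n + 1)) k),
      (∀ (p : Proj (MvPolynomial.homogeneousSubmodule (Fin (n + 1)) k)) (F : MvPolynomial (Fin (n + 1)) k),
          F ∈ ((φ.hom : Proj _ → Proj _) p).asHomogeneousIdeal ↔ aeval B.toMvPolynomial F ∈ p.asHomogeneousIdeal) ∧
      (∀ (p : Proj (MvPolynomial.homogeneousSubmodule (Fin (n + 1)) k)) (F : MvPolynomial (Fin (n + 1)) k),
          F ∈ ((φ.inv : Proj _ → Proj _) p).asHomogeneousIdeal ↔ aeval B⁻¹.toMvPolynomial F ∈ p.asHomogeneousIdeal) ∧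
      (∀ s : MvPolynomial (Fin (n + 1)) k,
          φ.hom ⁻¹ᵁ Proj.basicOpen (MvPolynomial.homogeneousSubmodule (Fin (n + 1)) k) s =
            Proj.basicOpen (MvPolynomial.homogeneousSubmodule (Fin (n + 1)) k) (aeval B.toMvPolynomial s)) ∧
      (∀ s : MvPolynomial (Fin (n + 1)) k,
          φ.inv ⁻¹ᵁ Proj.basicOpen (MvPolynomial.homogeneousSubmodule (Fin (n + 1)) k) s =
            Proj.basicOpen (MvPolynomial.homogeneousSubmodule (Fin (n + 1)) k) (aeval B⁻¹.toMvPolynomial s)) := by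
  obtain ⟨g, g', hg, hg', φ, h1, h2, h3, h4⟩ := exists_iso_eq_map hB
  refine ⟨φ, fun p F => ?_, fun p F => ?_, fun s => ?_, fun s => ?_⟩
  · rw [h3, ← h1 F]; exact Iff.rfl
  · rw [h4, ← h2 F]; exact Iff.rfl
  · rw [h3, Proj.map_preimage_basicOpen, h1]
  · rw [h4, Proj.map_preimage_basicOpen, h2]

end ProjLin

end Summit.ResolutionOfSingularities.ResolutionOfSingularities.Cruxes.EquisingularLiftNat.Sections

end
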